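import Summits.BirchSwinnertonDyer.BirchSwinnertonDyer.Theorems.ManinLocalTwoThreeManinPrimeToAdditiveFiveLeOrdinaryCornerOffTable
import Summits.BirchSwinnertonDyer.BirchSwinnertonDyer.Theorems.ManinLocalTwoThreeManinPrimeToAdditiveFiveLeSupersingularCornerTwistTransport
import Summits.BirchSwinnertonDyer.BirchSwinnertonDyer.Theorems.ManinLocalTwoThreeManinPrimeToAdditiveFiveLeBistarredKodaira
import Summits.BirchSwinnertonDyer.BirchSwinnertonDyer.Theorems.TeichmullerTwistDescentStarInvolutionCells
import Literature.NumberTheory.EllipticCurves.IsogenyPotentiallyGoodOrdinaryMinimalDiscriminant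
import HarnessLib

/-!
# Route `ManinLocalTwoThree`, residual crux C5 `ManinPrimeToAdditiveFiveLe` (stmt-BirchSwinnertonDyer-22969), line `upper_anchor`
# (skeleton v14, registered stub `stub_ord57` = `TwistFamilyManinDescent.OrdinaryCornerManinResidual` stmt-27552):
# **the STARRED rows of the ordinary corner ride the UNSTARRED rows, GRANTED Dokchitser–Dokchitser 2015 Thm. 5.1 (1)** —
# stmt-27552 ⟸ stmt-27552 restricted to the rows `(5; 3)`, `(7; 2)`, `(7; 4)` ∧ D–D

Lead seat bsd-line-ml23-c5-p1 (gen 7). Route `TwistFamilyManinDescent`'s LINE 18R carries the potentially ORDINARY `W[p]`-reducible corner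
(stmt-27552: rows `(5; III/III*)`, `(7; II/IV/IV*/II*)`) by three leaves I9 (27660) ∧ K18a″ (27661) ∧ K18b″ (27662), of which the orientation law
I9 and the reader item K18a″ are stated on ALL table rows — the STARRED rows `(5; 9)`, `(7; 8)`, `(7; 10)` included (there K18a″'s «`p ∣ c ⟹
ord_p Δ_min < 6`» is the whole content). THIS FILE shows that the starred rows need NO leaf of their own once D–D 2015 Thm. 5.1 (1) (cite-only
`dokchitser_padicValInt_minimalDiscriminantInt_eq_of_isogeny_of_potentiallyGoodOrdinary`, already a print of C5's cone, `_holds` under construction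
by seat bsd-line-ttd-p1) is granted:

* `ordinaryCornerManinResidual_of_unstarredRows_of_dokchitser` — **stmt-27552 ⟸ D–D ∧ its own restriction to the UNSTARRED rows `(5; 3)`,
  `(7; 2)`, `(7; 4)`.** For a STARRED optimal `W` (row `(5;9)`, `(7;8)` or `(7;10)`; (G)-ordinary by the lead's gen-4 dictionary
  `typeGOrd_iff_eq_nine_of_starred_five` / `typeGOrd_iff_ne_nine_of_starred_seven`), the globally minimal model `V` of `W ⊗ p*` is UNSTARRED with
  `ord_p Δ_min(V) = ord_p Δ_min(W) − 6` (`unstarred_twist_of_starred`) and (G)-ordinary (`typeGOrd_iff_of_star_pair`); the lattice-optimal curve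
  `W₀` of the class of `V` has THE SAME `ord_p Δ_min` by D–D (ordinary rigidity) — so it sits on the unstarred row `(5;3)` / `(7;2)` / `(7;4)`,
  inherits `p² ∣ N(W₀) = N(W)`, reducibility and «`W₀ ⊗ p*` additive» — and the an-cell's irreducibility-free one-inclusion transport
  `maninConstant_dvd_of_isIsogenous_twist_pStar_of_padicValInt_lt_six` (θ: `c(D) ∣ c(D₀)` from the unstarred partner) carries `p ∤ c(D₀)` to
  `p ∤ c(D)`. The vacuous rows (`ord_p Δ_min = 6`, `Iₙ*`) are empty as in `OrdinaryCornerOffTable` (p636035). No degree identity, no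
  census orientation law, no Gealy–Klagsbrun.
CONSEQUENCE for route `TwistFamilyManinDescent`'s pens: I9 / K18a″ / K18b″ may be RESTRICTED to the three unstarred rows without loss
(K18b″ already is); the starred half of the ordinary corner is D–D bookkeeping. HONEST STATUS: conditional result (`--supports`, helper) on the
cite-only D–D fact and on the OPEN unstarred-row statement; nothing here proves 27552, any leaf, C5, Manin's conjecture or BSD.

References: [DokchitserDokchitser2015LocalInvariants] Thm. 5.1 (1), Thm. 3.2; [Stevens1989] Lemmas (5.2), (5.4); [EdixhovenManin1991] Thm. 3,
§4; [SilvermanATAEC1994] IV Table 4.1; [Pal2012] Prop. 2.5.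
-/

set_option autoImplicit false
-- the Theorems namespace of this sub repeats the summit name by design (D-0017 nested layout)
set_option linter.dupNamespace false

noncomputable section

open scoped Classical NumberField

namespace Summit.BirchSwinnertonDyer.BirchSwinnertonDyer.Theorems

open WeierstrassCurve IsDedekindDomain IsDedekindDomain.HeightOneSpectrum Rat.HeightOneSpectrum NumberField
  Literature.NumberTheory.EllipticCurves Literature.NumberTheory.EllipticCurves.ModularForms
  Literature.NumberTheory.EllipticCurves.Rank1Residual
  Literature.NumberTheory.DiophantineGeometry
  Summit.BirchSwinnertonDyer.Rank1Residual
  Summit.BirchSwinnertonDyer.Rank1Residual.ManinAdditive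
  Summit.BirchSwinnertonDyer.Rank1Residual.Additive
  Summit.BirchSwinnertonDyer.BirchSwinnertonDyer.Theorems.TeichmullerTwistDescentStarInvolution
  Summit.BirchSwinnertonDyer.BirchSwinnertonDyer.Theses.TwistFamilyManinDescent

/-- **A STARRED (G)-ordinary reducible optimal row is carried by the UNSTARRED partner, GRANTED D–D.** `W/ℚ` globally minimal with a
lattice-optimal conductor-level datum `D`, `p ≥ 5`, `p² ∣ N`, `W[p]` reducible, `W ⊗ p*` additive at `p`, `6 < ord_p Δ_min(W)` and `W`
(G)-ordinary at `p`: there is a globally minimal `W₀ ∼ W ⊗ p*` with a lattice-optimal conductor-level datum `D₀`, `p² ∣ N(W₀)`, `W₀[p]` reducible,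
`W₀ ⊗ p*` additive at `p`, `ord_p Δ_min(W₀) + 6 = ord_p Δ_min(W)`, and `c(D) ∣ c(D₀)`. [cite: DokchitserDokchitser2015LocalInvariants, Thm. 5.1 (1)]
[cite: Stevens1989, Lemmas (5.2), (5.4)] [cite: Pal2012, Prop. 2.5] -/
theorem exists_unstarredPartner_of_starred_typeGOrd_of_dokchitser (hnf : exists_isNewformOf)
    (hDD : dokchitser_padicValInt_minimalDiscriminantInt_eq_of_isogeny_of_potentiallyGoodOrdinary) {p : ℕ} [hpF : Fact p.Prime]
    (hp5 : 5 ≤ p) (W : WeierstrassCurve ℚ) [W.IsElliptic] [W.IsGloballyMinimal] [NeZero (W.conductorNorm ℤ)]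
    (D : ModularParametrizationData W (W.conductorNorm ℤ)) (hD : IsLatticeOptimal D)
    (hpN : p ^ 2 ∣ W.conductorNorm ℤ) (hred : ¬ W.HasIrreducibleModPGaloisRep p)
    (htw : ¬ ((W.quadraticTwist (((-1 : ℤ) ^ (p / 2) * p : ℤ) : ℚ)).HasGoodReductionAt
          ((Rat.HeightOneSpectrum.primesEquiv (R := ℤ)).symm ⟨p, hpF.out⟩) ∨
        (W.quadraticTwist (((-1 : ℤ) ^ (p / 2) * p : ℤ) : ℚ)).HasMultiplicativeReductionAt
          ((Rat.HeightOneSpectrum.primesEquiv (R := ℤ)).symm ⟨p, hpF.out⟩)))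
    (h6 : 6 < padicValInt p W.minimalDiscriminantInt) (hGo : TypeGOrd W p) :
    ∃ (W₀ : WeierstrassCurve ℚ) (_ : W₀.IsElliptic) (_ : W₀.IsGloballyMinimal) (_ : NeZero (W₀.conductorNorm ℤ))
      (D₀ : ModularParametrizationData W₀ (W₀.conductorNorm ℤ)),
      IsLatticeOptimal D₀ ∧ p ^ 2 ∣ W₀.conductorNorm ℤ ∧ ¬ W₀.HasIrreducibleModPGaloisRep p ∧
      ¬ ((W₀.quadraticTwist (((-1 : ℤ) ^ (p / 2) * p : ℤ) : ℚ)).HasGoodReductionAt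
          ((Rat.HeightOneSpectrum.primesEquiv (R := ℤ)).symm ⟨p, hpF.out⟩) ∨
        (W₀.quadraticTwist (((-1 : ℤ) ^ (p / 2) * p : ℤ) : ℚ)).HasMultiplicativeReductionAt
          ((Rat.HeightOneSpectrum.primesEquiv (R := ℤ)).symm ⟨p, hpF.out⟩)) ∧
      padicValInt p W₀.minimalDiscriminantInt + 6 = padicValInt p W.minimalDiscriminantInt ∧ D.c ∣ D₀.c := by
  have hp : p.Prime := hpF.out
  have hp2 : p ≠ 2 := by omega
  obtain ⟨hcast, -⟩ := pStar_intCast p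
  have hd0 : ((((-1 : ℤ) ^ (p / 2) * p : ℤ)) : ℚ) ≠ 0 := by
    push_cast
    exact mul_ne_zero (pow_ne_zero _ (by norm_num)) (by exact_mod_cast hp.ne_zero)
  haveI : (W.quadraticTwist ((((-1 : ℤ) ^ (p / 2) * p : ℤ)) : ℚ)).IsElliptic := W.isElliptic_quadraticTwist hd0
  have hmod : nonempty_modularParametrizationData :=
    nonempty_modularParametrizationData_of_exists_isNewformOf hnf IsNewformOf.exists_maninConstant_ne_zero_holds
  have hadd : Addv W p := not_good_and_not_mult_of_sq_dvd_conductorNorm W hpN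
  have hj : 0 ≤ padicValRat p W.j := padicValRat_j_nonneg_of_addv_of_twist_pStar_not_semistable W p hp2 hadd htw
  -- the globally minimal model `V` of `W ⊗ p*`: UNSTARRED, (G)-ordinary
  obtain ⟨V, hVe, hVm, C, hC⟩ := exists_minimal_twist_pStar p W
  haveI := hVe
  haveI := hVm
  obtain ⟨hV, hjV, hvV, hV4, -⟩ := unstarred_twist_of_starred p hp5 W V hadd hj h6 C hC
  have hGoV : TypeGOrd V p := (typeGOrd_iff_of_star_pair p hp5 W V hadd hV hj hjV hvV).mp hGo
  have hPGO : V.HasPotentiallyGoodOrdinaryReductionAtPrime p := (typeGOrd_iff_exists_good_unitRoot V p hp5 hV).mp hGoV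
  -- the lattice-optimal curve `W₀` of the class of `V`; D–D: same `ord_p Δ_min`
  obtain ⟨W₀, hE₀, hM₀, hne₀, D₀, hD₀, hiso⟩ := exists_isIsogenous_latticeOptimal hnf V
  haveI := hE₀
  haveI := hM₀
  haveI := hne₀
  haveI : (W₀.quadraticTwist ((((-1 : ℤ) ^ (p / 2) * p : ℤ)) : ℚ)).IsElliptic := W₀.isElliptic_quadraticTwist hd0
  haveI : ((W.quadraticTwist ((((-1 : ℤ) ^ (p / 2) * p : ℤ)) : ℚ)).quadraticTwist
      ((((-1 : ℤ) ^ (p / 2) * p : ℤ)) : ℚ)).IsElliptic :=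
    (W.quadraticTwist ((((-1 : ℤ) ^ (p / 2) * p : ℤ)) : ℚ)).isElliptic_quadraticTwist hd0
  have hv₀ : padicValInt p W₀.minimalDiscriminantInt + 6 = padicValInt p W.minimalDiscriminantInt := by
    rw [← hDD V W₀ p hp hiso hPGO]; exact hvV
  -- `W ⊗ p* ∼ W₀` and `W ∼ W₀ ⊗ p*`
  have hC' : C • W.quadraticTwist ((((-1 : ℤ) ^ (p / 2) * p : ℤ)) : ℚ) = V := by rw [hcast]; exact hC
  have hisoT : IsIsogenous (W.quadraticTwist ((((-1 : ℤ) ^ (p / 2) * p : ℤ)) : ℚ)) W₀ := by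
    have h1 : IsIsogenous (W.quadraticTwist ((((-1 : ℤ) ^ (p / 2) * p : ℤ)) : ℚ)) V := by
      rw [← hC']; exact isIsogenous_smul _ _
    exact h1.trans' hiso
  have htw' : IsIsogenous W (W₀.quadraticTwist ((((-1 : ℤ) ^ (p / 2) * p : ℤ)) : ℚ)) := by
    obtain ⟨Cq, hCq⟩ := W.exists_variableChange_smul_eq_quadraticTwist_sq hd0
    have h1 : IsIsogenous W ((W.quadraticTwist ((((-1 : ℤ) ^ (p / 2) * p : ℤ)) : ℚ)).quadraticTwist
        ((((-1 : ℤ) ^ (p / 2) * p : ℤ)) : ℚ)) := by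
      rw [quadraticTwist_quadraticTwist, ← sq, ← hCq]
      exact isIsogenous_smul _ _
    exact h1.trans' (hisoT.quadraticTwist hd0)
  -- conductors: `p² ∣ N(W₀) = N(V) = N(W)`
  have hNV : V.conductorNorm ℤ = W.conductorNorm ℤ := conductorNorm_eq_of_twist_pStar p hp5 W V hadd hV C hC
  have hNN : W₀.conductorNorm ℤ = W.conductorNorm ℤ := by
    rw [← conductorNorm_eq_of_isIsogenous_of_modularity hmod _ _ hiso]; exact hNV
  have hpN₀ : p ^ 2 ∣ W₀.conductorNorm ℤ := by rw [hNN]; exact hpN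
  -- `W₀ ⊗ p*` is additive at `p` (isogenous to `W`), `W₀[p]` reducible
  have htw₀ : ¬ ((W₀.quadraticTwist (((-1 : ℤ) ^ (p / 2) * p : ℤ) : ℚ)).HasGoodReductionAt
          ((Rat.HeightOneSpectrum.primesEquiv (R := ℤ)).symm ⟨p, hpF.out⟩) ∨
        (W₀.quadraticTwist (((-1 : ℤ) ^ (p / 2) * p : ℤ) : ℚ)).HasMultiplicativeReductionAt
          ((Rat.HeightOneSpectrum.primesEquiv (R := ℤ)).symm ⟨p, hpF.out⟩)) := by
    apply not_good_or_mult_at_primesEquiv_symm_of_sq_dvd_conductorNorm _ hp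
    rw [← conductorNorm_eq_of_isIsogenous_of_modularity hmod _ _ htw']
    exact hpN
  have hred₀ : ¬ W₀.HasIrreducibleModPGaloisRep p := fun h ↦
    not_hasIrreducibleModPGaloisRep_of_isIsogenous htw' hred
      ((hasIrreducibleModPGaloisRep_quadraticTwist_iff W₀ hd0 p).mpr h)
  -- θ: `c(D) ∣ c(D₀)` from the unstarred partner
  have hdvd := maninConstant_dvd_of_isIsogenous_twist_pStar_of_padicValInt_lt_six hp2 W₀ W D₀ D hD hpN₀ hNN.symm htw'
    (by omega)
  exact ⟨W₀, hE₀, hM₀, hne₀, D₀, hD₀, hpN₀, hred₀, htw₀, hv₀, hdvd⟩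

/-- **`OrdinaryCornerManinResidual` (stmt-BirchSwinnertonDyer-27552) ⟸ D–D 2015 Thm. 5.1 (1) ∧ its own restriction to the UNSTARRED rows
`(5; 3)`, `(7; 2)`, `(7; 4)`** (`hUn`: the binders of stmt-27552 with the row predicate replaced by the three unstarred ordinary rows).
Level = conductor (Carayol); `ord_p Δ_min ∈ {2,3,4,6,8,9,10}`; the Raynaud rows, the supersingular rows and `ord_p Δ_min = 6` are excluded /
empty (`padicValInt_minimalDiscriminantInt_ne_six_of_twist_pStar_not_semistable`); unstarred rows by `hUn`; starred rows `(5;9)`, `(7;8)`, `(7;10)`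
((G)-ordinary by `typeGOrd_iff_eq_nine_of_starred_five` / `typeGOrd_iff_ne_nine_of_starred_seven`) by
`exists_unstarredPartner_of_starred_typeGOrd_of_dokchitser` and `hUn` at the partner. Conditional result (`--supports`, helper).
[cite: DokchitserDokchitser2015LocalInvariants, Thm. 5.1 (1) and Thm. 3.2] [cite: Stevens1989, Lemmas (5.2), (5.4)] [cite: SilvermanATAEC1994, IV Table 4.1] -/
theorem ordinaryCornerManinResidual_of_unstarredRows_of_dokchitser
    (hDD : dokchitser_padicValInt_minimalDiscriminantInt_eq_of_isogeny_of_potentiallyGoodOrdinary)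
    (hUn : mazur_not_dvd_maninConstant_of_odd → abbesUllmo_not_dvd_maninConstant_of_not_dvd_level →
      cesnavicius_not_two_dvd_maninConstant_of_two_dvd_level → exists_isNewformOf →
      ∀ (W : WeierstrassCurve ℚ) [W.IsElliptic] [W.IsGloballyMinimal] {N : ℕ} [NeZero N]
        (D : ModularParametrizationData W N) (p : ℕ) (hp : p.Prime),
        ((p = 5 ∧ padicValInt 5 W.minimalDiscriminantInt = 3) ∨
          (p = 7 ∧ padicValInt 7 W.minimalDiscriminantInt ∈ ({2, 4} : Finset ℕ))) →
        p ^ 2 ∣ N → ¬ W.HasIrreducibleModPGaloisRep p →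
        ¬ ((W.quadraticTwist (((-1 : ℤ) ^ (p / 2) * p : ℤ) : ℚ)).HasGoodReductionAt
            ((Rat.HeightOneSpectrum.primesEquiv (R := ℤ)).symm ⟨p, hp⟩) ∨
          (W.quadraticTwist (((-1 : ℤ) ^ (p / 2) * p : ℤ) : ℚ)).HasMultiplicativeReductionAt
            ((Rat.HeightOneSpectrum.primesEquiv (R := ℤ)).symm ⟨p, hp⟩)) →
        (∀ z ∈ D.L.lattice, ∃ w ∈ periodLattice D.f, z = D.c * w) → ¬ (p : ℤ) ∣ D.maninConstant) :
    OrdinaryCornerManinResidual := by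
  intro hM hAU hC hnf W _ _ N _ D p hp h57 hRay hSS hpN hred htw hopt
  haveI hpF : Fact p.Prime := ⟨hp⟩
  obtain rfl : N = W.conductorNorm ℤ := IsNewformOf.level_eq_conductorNorm_of_exists_isNewformOf hnf D.isNewformOf
  have hp5 : 5 ≤ p := by rcases h57 with rfl | rfl <;> norm_num
  have hp2 : p ≠ 2 := by omega
  have hadd : Addv W p := not_good_and_not_mult_of_sq_dvd_conductorNorm W hpN
  have hj : 0 ≤ padicValRat p W.j := padicValRat_j_nonneg_of_addv_of_twist_pStar_not_semistable W p hp2 hadd htw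
  have h6 := padicValInt_minimalDiscriminantInt_ne_six_of_twist_pStar_not_semistable hp5 W hpN htw
  have hmem := padicValInt_minimalDiscriminantInt_mem_of_addv_of_padicValRat_j_nonneg W p hp5 hadd hj
  have hI := forall_kodairaSymbolAt_ne_Istar_of_padicValRat_j_nonneg_of_ne_six W p hp5 hadd hj h6
  -- the starred (G)-ordinary rows, carried by the unstarred partner
  have hstar : 6 < padicValInt p W.minimalDiscriminantInt → TypeGOrd W p → ¬ (p : ℤ) ∣ D.maninConstant := by
    intro h6' hGo hpc
    obtain ⟨W₀, hE₀, hM₀, hne₀, D₀, hD₀, hpN₀, hred₀, htw₀, hv₀, hdvd⟩ :=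
      exists_unstarredPartner_of_starred_typeGOrd_of_dokchitser hnf hDD hp5 W D hopt hpN hred htw h6' hGo
    haveI := hE₀
    haveI := hM₀
    haveI := hne₀
    have hrow₀ : (p = 5 ∧ padicValInt 5 W₀.minimalDiscriminantInt = 3) ∨
        (p = 7 ∧ padicValInt 7 W₀.minimalDiscriminantInt ∈ ({2, 4} : Finset ℕ)) := by
      rcases h57 with rfl | rfl
      · refine Or.inl ⟨rfl, ?_⟩
        rcases hmem with h | h | h | h | h | h | h
        any_goals omega
        · exact absurd (Or.inl ⟨rfl, by simp [h]⟩) hRay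
        · exact absurd ⟨rfl, by simp [h]⟩ hSS
      · refine Or.inr ⟨rfl, ?_⟩
        simp only [Finset.mem_insert, Finset.mem_singleton]
        rcases hmem with h | h | h | h | h | h | h
        any_goals omega
        exact absurd (Or.inr ⟨rfl, by simp [h]⟩) hRay
    exact hUn hM hAU hC hnf W₀ D₀ p hp hrow₀ hpN₀ hred₀ htw₀ hD₀ (hpc.trans hdvd)
  rcases h57 with rfl | rfl
  · rcases hmem with h | h | h | h | h | h | h
    · exact absurd ⟨rfl, by simp [h]⟩ hSS
    · exact hUn hM hAU hC hnf W D 5 hp (Or.inl ⟨rfl, h⟩) hpN hred htw hopt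
    · exact absurd (Or.inl ⟨rfl, by simp [h]⟩) hRay
    · exact absurd h h6
    · exact absurd (Or.inl ⟨rfl, by simp [h]⟩) hRay
    · exact hstar (by omega) ((typeGOrd_iff_eq_nine_of_starred_five W 5 rfl hadd hI (by omega)).mpr h)
    · exact absurd ⟨rfl, by simp [h]⟩ hSS
  · rcases hmem with h | h | h | h | h | h | h
    · exact hUn hM hAU hC hnf W D 7 hp (Or.inr ⟨rfl, by simp [h]⟩) hpN hred htw hopt
    · exact absurd (Or.inr ⟨rfl, by simp [h]⟩) hRay
    · exact hUn hM hAU hC hnf W D 7 hp (Or.inr ⟨rfl, by simp [h]⟩) hpN hred htw hopt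
    · exact absurd h h6
    · exact hstar (by omega) ((typeGOrd_iff_ne_nine_of_starred_seven W 7 rfl hadd hI (by omega)).mpr (by omega))
    · exact absurd (Or.inr ⟨rfl, by simp [h]⟩) hRay
    · exact hstar (by omega) ((typeGOrd_iff_ne_nine_of_starred_seven W 7 rfl hadd hI (by omega)).mpr (by omega))

end Summit.BirchSwinnertonDyer.BirchSwinnertonDyer.Theorems

end
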